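import Literature.Algebra.Lie.ChevalleyEilenbergPostComposition
import Literature.NumberTheory.Automorphic.GKCohomologyFunctor
import Literature.NumberTheory.Automorphic.GKSubquotient
import Literature.NumberTheory.Automorphic.GKModulesOneParameter
import Literature.RepresentationTheory.CompactGroups.FiniteDimensionalSemisimple
import HarnessLib

/-!
# The short exact sequence of relative complexes of `0 → U → V → V/U → 0`

Topic `NumberTheory/Automorphic`; namespace `Literature.NumberTheory.Automorphic.GKSubmodule`.

For a `(𝔤, K)`-module `V` (`IsGKModule`) of a real matrix group `G` and a `(𝔤, K)`-stable
subspace `U` (`GKSubquotient`: `subLie`, `quotLie`, `isGKModule_sub`, `isGKModule_quot`), the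
inclusion and the projection induce cochain maps of `(𝔤, K)`-complexes
`C^•(𝔤, K; U) → C^•(𝔤, K; V) → C^•(𝔤, K; V/U)` (`isCochainMapTo_incl`, `isCochainMapTo_proj`),
and this sequence is **degreewise short exact**: injective on the left (`inclMap_injective`),
composite zero (`projMap_inclMap`), exact in the middle on relative cochains
(`exists_inclMap_eq`), and — when `K` is compact — surjective on the right on relative cochains
(`exists_projMap_eq`). The last point is Borel–Wallach's remark that exact sequences of
`(𝔤, K)`-modules split over `𝔨` (I §2.2–2.3): the locally finite weakly continuous `K`-action is
completely reducible (`CompactGroups.isSemisimpleRepresentation_of_locallyFinite_of_continuous`),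
a `K`-stable complement of `U` is `𝔨`-stable (`IsGKModule.apply_mem_of_expK_stable`), and
post-composition with the resulting `K`- and `𝔨`-equivariant section preserves relative cochains
(`ChevalleyEilenberg.mem_gK_post_of_comm`). These are exactly the hypotheses of the long exact
cohomology sequence of `Literature/Algebra/Lie/ChevalleyEilenbergLongExactSequence.lean`.

No `sorry`, no new named facts.

## References
* [BorelWallach2000] A. Borel, N. Wallach, *Continuous cohomology, discrete subgroups, and
  representations of reductive groups*, 2nd ed., AMS 2000, I §2.2–§2.3, §5.1.
* [KnappVogan1995] A. W. Knapp, D. A. Vogan, *Cohomological induction and unitary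
  representations*, Princeton 1995, Prop. 1.18.
-/

noncomputable section

namespace Literature.NumberTheory.Automorphic

open Module Function Literature.Algebra.Lie

/- [extends Literature/NumberTheory/Automorphic/GKSubquotient] and
[extends Literature/NumberTheory/Automorphic/GKCohomologyFunctor]: the cochain maps of the
inclusion / projection and the degreewise short exact sequence of relative complexes. -/

-- Mathlib idiom (as in `GKModules`): commutator bracket on `Module.End`
attribute [local instance 100] LieRing.ofAssociativeRing

variable {A : Type*} [NormedCommRing A] [NormedAlgebra ℝ A] [NormedAlgebra ℚ A] [CompleteSpace A]
  [StarRing A] {N : Type*} [Fintype N] [DecidableEq N] (G : RealMatrixGroup A N)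
  {V : Type*} [AddCommGroup V] [Module ℂ V]
  (ρK : Representation ℂ G.maximalCompact V) (ρ𝔤 : G.lie →ₗ⁅ℝ⁆ Module.End ℂ V)
  {W : Type*} [AddCommGroup W] [Module ℂ W]
  (σK : Representation ℂ G.maximalCompact W) (σ𝔤 : G.lie →ₗ⁅ℝ⁆ Module.End ℂ W)

/-! #### Plain linear maps between carriers and post-composition -/

/-- A `ℂ`-linear map `T : V → W` as a real-linear map of carriers (no equivariance). [folklore] -/
def GKCarrier.linear (T : V →ₗ[ℂ] W) : GKCarrier G ρ𝔤 →ₗ[ℝ] GKCarrier G σ𝔤 where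
  toFun v := (T (v : V) : W)
  map_add' v w := T.map_add (v : V) (w : V)
  map_smul' t v := T.map_smul_of_tower t (v : V)

/-- [folklore] -/
@[simp] theorem GKCarrier.linear_apply (T : V →ₗ[ℂ] W) (v : GKCarrier G ρ𝔤) :
    GKCarrier.linear G ρ𝔤 σ𝔤 T v = T v := rfl

/-- The cochain map of a `(𝔤, K)`-map is post-composition with the underlying linear map.
[folklore] -/
theorem map_hom_eq_post (T : V →ₗ[ℂ] W) (hT𝔤 : ∀ X : G.lie, T ∘ₗ ρ𝔤 X = σ𝔤 X ∘ₗ T) (q : ℕ) :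
    ChevalleyEilenberg.map G.lie (GKCarrier.hom G ρ𝔤 σ𝔤 T hT𝔤) q =
      ChevalleyEilenberg.post G.lie (GKCarrier.linear G ρ𝔤 σ𝔤 T) q := by
  refine LinearMap.ext fun f => ?_
  ext v
  rfl

namespace GKSubmodule

variable (U : Submodule ℂ V)

/-! #### The inclusion `U → V` and the projection `V → V/U` -/

/-- [folklore] -/
theorem subtype_comm𝔤 (h𝔤 : ∀ X : G.lie, U ≤ U.comap (ρ𝔤 X)) (X : G.lie) :
    U.subtype ∘ₗ subLie G ρ𝔤 U h𝔤 X = ρ𝔤 X ∘ₗ U.subtype :=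
  rfl

/-- [folklore] -/
theorem subtype_commK (hK : ∀ k : G.maximalCompact, U ≤ U.comap (ρK k)) (k : G.maximalCompact) :
    U.subtype ∘ₗ ρK.subrepresentation U hK k = ρK k ∘ₗ U.subtype :=
  rfl

/-- [folklore] -/
theorem mkQ_comm𝔤 (h𝔤 : ∀ X : G.lie, U ≤ U.comap (ρ𝔤 X)) (X : G.lie) :
    U.mkQ ∘ₗ ρ𝔤 X = quotLie G ρ𝔤 U h𝔤 X ∘ₗ U.mkQ :=
  rfl

/-- [folklore] -/
theorem mkQ_commK (hK : ∀ k : G.maximalCompact, U ≤ U.comap (ρK k)) (k : G.maximalCompact) :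
    U.mkQ ∘ₗ ρK k = ρK.quotient U hK k ∘ₗ U.mkQ :=
  rfl

/-- The cochain map `C^•(𝔤; U) → C^•(𝔤; V)` of the inclusion. [cite: BorelWallach2000, I §5.1] -/
abbrev inclMap (h𝔤 : ∀ X : G.lie, U ≤ U.comap (ρ𝔤 X)) (q : ℕ) :
    ChevalleyEilenberg.Cochain ℝ G.lie (GKCarrier G (subLie G ρ𝔤 U h𝔤)) q →ₗ[ℝ]
      ChevalleyEilenberg.Cochain ℝ G.lie (GKCarrier G ρ𝔤) q :=
  ChevalleyEilenberg.map G.lie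
    (GKCarrier.hom G (subLie G ρ𝔤 U h𝔤) ρ𝔤 U.subtype (subtype_comm𝔤 G ρ𝔤 U h𝔤)) q

/-- The cochain map `C^•(𝔤; V) → C^•(𝔤; V/U)` of the projection. [cite: BorelWallach2000, I §5.1] -/
abbrev projMap (h𝔤 : ∀ X : G.lie, U ≤ U.comap (ρ𝔤 X)) (q : ℕ) :
    ChevalleyEilenberg.Cochain ℝ G.lie (GKCarrier G ρ𝔤) q →ₗ[ℝ]
      ChevalleyEilenberg.Cochain ℝ G.lie (GKCarrier G (quotLie G ρ𝔤 U h𝔤)) q :=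
  ChevalleyEilenberg.map G.lie
    (GKCarrier.hom G ρ𝔤 (quotLie G ρ𝔤 U h𝔤) U.mkQ (mkQ_comm𝔤 G ρ𝔤 U h𝔤)) q

/-- The inclusion of cochains is injective. [folklore] -/
theorem inclMap_injective (h𝔤 : ∀ X : G.lie, U ≤ U.comap (ρ𝔤 X)) (q : ℕ) :
    Injective (inclMap G ρ𝔤 U h𝔤 q) := by
  rw [show inclMap G ρ𝔤 U h𝔤 q = _ from map_hom_eq_post G _ _ U.subtype _ q]
  exact ChevalleyEilenberg.post_injective
    (ψ := GKCarrier.linear G (subLie G ρ𝔤 U h𝔤) ρ𝔤 U.subtype) (fun a b h => Subtype.ext h) q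

/-- `proj ∘ incl = 0`. [folklore] -/
theorem projMap_inclMap (h𝔤 : ∀ X : G.lie, U ≤ U.comap (ρ𝔤 X)) (q : ℕ)
    (f : ChevalleyEilenberg.Cochain ℝ G.lie (GKCarrier G (subLie G ρ𝔤 U h𝔤)) q) :
    projMap G ρ𝔤 U h𝔤 q (inclMap G ρ𝔤 U h𝔤 q f) = 0 := by
  ext v
  exact (Submodule.Quotient.mk_eq_zero U).2 (show ↥U from f v).2

/-! #### Sections of `V → V/U` -/

/-- For a complement `U'` of `U`, the linear section `V/U ≅ U' ⊆ V`. [folklore] -/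
def section' {U' : Submodule ℂ V} (hUU' : IsCompl U U') : (V ⧸ U) →ₗ[ℂ] V :=
  U'.subtype ∘ₗ (Submodule.quotientEquivOfIsCompl U U' hUU').toLinearMap

/-- [folklore] -/
theorem mkQ_section' {U' : Submodule ℂ V} (hUU' : IsCompl U U') (w : V ⧸ U) :
    U.mkQ (section' U hUU' w) = w :=
  Submodule.mk_quotientEquivOfIsCompl_apply hUU' w

/-- [folklore] -/
theorem section'_mem {U' : Submodule ℂ V} (hUU' : IsCompl U U') (w : V ⧸ U) :
    section' U hUU' w ∈ U' :=
  (Submodule.quotientEquivOfIsCompl U U' hUU' w).2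

/-- [folklore] -/
theorem section'_mkQ_of_mem {U' : Submodule ℂ V} (hUU' : IsCompl U U') {v : V} (hv : v ∈ U') :
    section' U hUU' (U.mkQ v) = v := by
  have h := Submodule.quotientEquivOfIsCompl_apply_mk_right (p := U) (q := U') hUU' ⟨v, hv⟩
  change ((Submodule.quotientEquivOfIsCompl U U' hUU' (Submodule.Quotient.mk v) : U') : V) = v
  rw [h]

/-- The section is `K`-equivariant when `U'` is `K`-stable. [folklore] -/
theorem section'_commK (hK : ∀ k : G.maximalCompact, U ≤ U.comap (ρK k)) {U' : Submodule ℂ V}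
    (hUU' : IsCompl U U') (hU' : ∀ k : G.maximalCompact, U' ≤ U'.comap (ρK k))
    (k : G.maximalCompact) (w : V ⧸ U) :
    section' U hUU' (ρK.quotient U hK k w) = ρK k (section' U hUU' w) := by
  conv_lhs => rw [← mkQ_section' U hUU' w]
  change section' U hUU' (U.mkQ (ρK k (section' U hUU' w))) = _
  exact section'_mkQ_of_mem U hUU' (hU' k (section'_mem U hUU' w))

/-- Complements in the lattice of subrepresentations are complements of submodules.
[folklore] -/
theorem isCompl_toSubmodule {T T' : Subrepresentation ρK} (h : IsCompl T T') :
    IsCompl T.toSubmodule T'.toSubmodule := by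
  refine ⟨?_, ?_⟩
  · rw [disjoint_iff, ← Subrepresentation.toSubmodule_inf, h.1.eq_bot]
    rfl
  · rw [codisjoint_iff, ← Subrepresentation.toSubmodule_sup, h.2.eq_top]
    rfl

variable [StarModule ℝ A] [ContinuousStar A]

/-- A `K`-stable subspace of a `(𝔤, K)`-module is `𝔨`-stable (differentiate `exp tX`).
[cite: BorelWallach2000, I §2.3] -/
theorem apply_mem_of_stable (hV : IsGKModule G ρK ρ𝔤) {U' : Submodule ℂ V}
    (hU' : ∀ k : G.maximalCompact, U' ≤ U'.comap (ρK k)) (X : G.lie) (hX : X ∈ G.kInLie)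
    {v : V} (hv : v ∈ U') : ρ𝔤 X v ∈ U' := by
  have hXc : (X : Matrix N N A) ∈ G.compactLie := (G.mem_kInLie_iff X).1 hX
  exact hV.apply_mem_of_expK_stable ⟨(X : Matrix N N A), hXc⟩ (U := U')
    (fun t u hu => hU' _ hu) hv

/-- The section is `𝔨`-equivariant when `U'` is `K`-stable. [cite: BorelWallach2000, I §2.3] -/
theorem section'_comm𝔨 (hV : IsGKModule G ρK ρ𝔤) (h𝔤 : ∀ X : G.lie, U ≤ U.comap (ρ𝔤 X))
    {U' : Submodule ℂ V} (hUU' : IsCompl U U') (hU' : ∀ k : G.maximalCompact, U' ≤ U'.comap (ρK k))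
    (X : G.lie) (hX : X ∈ G.kInLie) (w : V ⧸ U) :
    section' U hUU' (quotLie G ρ𝔤 U h𝔤 X w) = ρ𝔤 X (section' U hUU' w) := by
  conv_lhs => rw [← mkQ_section' U hUU' w]
  rw [Submodule.mkQ_apply, quotLie_mk]
  exact section'_mkQ_of_mem U hUU'
    (apply_mem_of_stable G ρK ρ𝔤 hV hU' X hX (section'_mem U hUU' w))

/-- **A `K`-stable complement of `U`** exists when `K` is compact (complete reducibility of the
locally finite weakly continuous `K`-action of a `(𝔤, K)`-module).
[cite: KnappVogan1995, Prop. 1.18] [cite: BorelWallach2000, I §2.2] -/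
theorem exists_isCompl_stable [CompactSpace G.maximalCompact] (hV : IsGKModule G ρK ρ𝔤)
    (hK : ∀ k : G.maximalCompact, U ≤ U.comap (ρK k)) :
    ∃ U' : Submodule ℂ V, IsCompl U U' ∧ ∀ k : G.maximalCompact, U' ≤ U'.comap (ρK k) := by
  haveI : ρK.IsSemisimpleRepresentation :=
    Literature.RepresentationTheory.CompactGroups.isSemisimpleRepresentation_of_locallyFinite_of_continuous
      ρK hV.kFinite hV.weaklyContinuous
  obtain ⟨T', hT'⟩ := exists_isCompl (⟨U, fun k _ hv => hK k hv⟩ : Subrepresentation ρK)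
  exact ⟨T'.toSubmodule, isCompl_toSubmodule G ρK hT', fun k v hv => T'.apply_mem_toSubmodule k hv⟩

/-! #### The three `(𝔤, K)`-complexes and the degreewise short exact sequence -/

variable (hK : ∀ k : G.maximalCompact, U ≤ U.comap (ρK k))
  (h𝔤 : ∀ X : G.lie, U ≤ U.comap (ρ𝔤 X)) (hV : IsGKModule G ρK ρ𝔤)

/-- **The inclusion is a cochain map of `(𝔤, K)`-complexes** `C^•(𝔤, K; U) → C^•(𝔤, K; V)`.
[cite: BorelWallach2000, I §5.1] -/
theorem isCochainMapTo_incl :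
    (gkComplex G (ρK.subrepresentation U hK) (subLie G ρ𝔤 U h𝔤)
        (isGKModule_sub G ρK ρ𝔤 U hK h𝔤 hV).ad_compat).IsCochainMapTo
      (gkComplex G ρK ρ𝔤 hV.ad_compat) (inclMap G ρ𝔤 U h𝔤) :=
  isCochainMapTo_hom G _ _ ρK ρ𝔤 _ _ U.subtype _ (subtype_commK G ρK U hK)

/-- **The projection is a cochain map of `(𝔤, K)`-complexes** `C^•(𝔤, K; V) → C^•(𝔤, K; V/U)`.
[cite: BorelWallach2000, I §5.1] -/
theorem isCochainMapTo_proj :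
    (gkComplex G ρK ρ𝔤 hV.ad_compat).IsCochainMapTo
      (gkComplex G (ρK.quotient U hK) (quotLie G ρ𝔤 U h𝔤)
        (isGKModule_quot G ρK ρ𝔤 U hK h𝔤 hV).ad_compat) (projMap G ρ𝔤 U h𝔤) :=
  isCochainMapTo_hom G ρK ρ𝔤 _ _ _ _ U.mkQ _ (mkQ_commK G ρK U hK)

/-- **Exactness in the middle, on `(𝔤, K)`-cochains**: a `(𝔤, K)`-cochain of `V` that dies in
`V/U` comes from a `(𝔤, K)`-cochain of `U`. [cite: BorelWallach2000, I §2.2] -/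
theorem exists_inclMap_eq (q : ℕ) (g : ChevalleyEilenberg.Cochain ℝ G.lie (GKCarrier G ρ𝔤) q)
    (hg : g ∈ (gkComplex G ρK ρ𝔤 hV.ad_compat).carrier q) (h0 : projMap G ρ𝔤 U h𝔤 q g = 0) :
    ∃ f ∈ (gkComplex G (ρK.subrepresentation U hK) (subLie G ρ𝔤 U h𝔤)
        (isGKModule_sub G ρK ρ𝔤 U hK h𝔤 hV).ad_compat).carrier q, inclMap G ρ𝔤 U h𝔤 q f = g := by
  rw [show projMap G ρ𝔤 U h𝔤 q = _ from map_hom_eq_post G _ _ U.mkQ _ q] at h0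
  obtain ⟨f, hf⟩ := ChevalleyEilenberg.exists_post_eq_of_post_eq_zero
    (GKCarrier.linear G (subLie G ρ𝔤 U h𝔤) ρ𝔤 U.subtype) (fun a b h => Subtype.ext h)
    (GKCarrier.linear G ρ𝔤 (quotLie G ρ𝔤 U h𝔤) U.mkQ)
    (fun m hm => ⟨⟨m, (Submodule.Quotient.mk_eq_zero U).1 hm⟩, rfl⟩) q g h0
  refine ⟨f, ?_, ?_⟩
  · refine ChevalleyEilenberg.mem_gK_of_post_mem G.kInLie
      (gkPairAction G (ρK.subrepresentation U hK) (subLie G ρ𝔤 U h𝔤)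
        (isGKModule_sub G ρK ρ𝔤 U hK h𝔤 hV).ad_compat)
      (gkPairAction G ρK ρ𝔤 hV.ad_compat)
      (GKCarrier.linear G (subLie G ρ𝔤 U h𝔤) ρ𝔤 U.subtype) (fun a b h => Subtype.ext h)
      (fun _ => rfl) (fun k u => rfl) (fun X _ u => rfl) q f ?_
    rw [hf]
    exact hg
  · rw [show inclMap G ρ𝔤 U h𝔤 q = _ from map_hom_eq_post G _ _ U.subtype _ q]
    exact hf

/-- **Surjectivity on `(𝔤, K)`-cochains** (`K` compact): every `(𝔤, K)`-cochain of `V/U` lifts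
to a `(𝔤, K)`-cochain of `V` — post-composition with a `K`-equivariant, hence `𝔨`-equivariant,
section ("exact sequences of `(𝔤, K)`-modules split over `𝔨`").
[cite: BorelWallach2000, I §2.2–2.3] -/
theorem exists_projMap_eq [CompactSpace G.maximalCompact] (q : ℕ)
    (h : ChevalleyEilenberg.Cochain ℝ G.lie (GKCarrier G (quotLie G ρ𝔤 U h𝔤)) q)
    (hh : h ∈ (gkComplex G (ρK.quotient U hK) (quotLie G ρ𝔤 U h𝔤)
        (isGKModule_quot G ρK ρ𝔤 U hK h𝔤 hV).ad_compat).carrier q) :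
    ∃ g ∈ (gkComplex G ρK ρ𝔤 hV.ad_compat).carrier q, projMap G ρ𝔤 U h𝔤 q g = h := by
  obtain ⟨U', hUU', hU'⟩ := exists_isCompl_stable G ρK ρ𝔤 U hV hK
  let s : GKCarrier G (quotLie G ρ𝔤 U h𝔤) →ₗ[ℝ] GKCarrier G ρ𝔤 :=
    GKCarrier.linear G (quotLie G ρ𝔤 U h𝔤) ρ𝔤 (section' U hUU')
  refine ⟨ChevalleyEilenberg.post G.lie s q h, ?_, ?_⟩
  · exact ChevalleyEilenberg.mem_gK_post_of_comm G.kInLie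
      (gkPairAction G (ρK.quotient U hK) (quotLie G ρ𝔤 U h𝔤)
        (isGKModule_quot G ρK ρ𝔤 U hK h𝔤 hV).ad_compat)
      (gkPairAction G ρK ρ𝔤 hV.ad_compat) s (fun _ => rfl)
      (fun k w => section'_commK G ρK U hK hUU' hU' k w)
      (fun X hX w => section'_comm𝔨 G ρK ρ𝔤 U hV h𝔤 hUU' hU' X hX w) q h hh
  · rw [show projMap G ρ𝔤 U h𝔤 q = _ from map_hom_eq_post G _ _ U.mkQ _ q,
      ChevalleyEilenberg.post_comp_apply]
    ext v
    exact mkQ_section' U hUU' (h v)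

end GKSubmodule

end Literature.NumberTheory.Automorphic

end
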